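import Mathlib
import Summits.NavierStokesRegularity.NavierStokesRegularity.Theorems.TaoLadderRungTwoBreakOneShiftWindowTermFieldSmooth
import HarnessLib

/-!
# The one-shift window system, XXII: HOMOGENISATION — a term-list field with constant external factors (the flat
# CENTRE field) is the slice `x̂_⋆ = 1` of a BILINEAR field `Q(x̂, x̂)` on `ι ⊕ Unit`, the format of the tree's C¹
# Taylor-model theory for bilinear fields (`TaylorModelVector.hasFDerivWithinAt_flow`, K1b-DR line); solutions lift,
# and a derivative of the lifted flow within the lifted start set descends to the slice (cell harvest/h2-tao-ladder,
# seat p2; rung1/KERNEL-CHEAP-REPLAY-SPEC.md §7 (R2); support for K1(1) = `NoSurvivingDSSOne`, stmt-NavierStokesRegularity-20205)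

MODEL lattice ODEs only (Tao 2016 §4 normal form on Tao's shift set `S`); nothing here is a statement about
the Navier–Stokes equations; no item is closed; nothing numerical is proved. Generic in `ι`, `κ`.

* `lift x = (x, 1)` on `ι ⊕ Unit`, `liftCLM` (the linear part `z ↦ (z, 0)`), `projCLM` (back to `ι`);
* `Factor.lin` — a factor as a LINEAR functional of the lifted state (`ext e ↦ e · x̂_⋆`), `Factor.lin_lift`;
* `termBilin T` — the bilinear map with `termBilin T (lift x) (lift x) = lift-components (termField T x, 0)`
  (`termBilin_lift_inl`, `termBilin_lift_inr`);
* `hasDerivWithinAt_lift` — a solution of `x' = termField T x` lifts to a solution of `x̂' = Q(x̂, x̂)`;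
* `hasFDerivWithinAt_of_lift` — if the lifted time-`t` map `x̂ ↦ Ψ x̂` has derivative `L̂` within `lift '' S` at `lift x`,
  then `x ↦ proj (Ψ (lift x))` has derivative `projCLM ∘ L̂ ∘ liftCLM` within `S` at `x` (chain rule with the affine
  embedding) — so the bilinear framework's flow derivative feeds part XIV `exists_slopeMatrix_of_fderiv`.
-/

noncomputable section

-- the sub-problem namespace repeats the summit name by design (D-0017)
set_option linter.dupNamespace false

namespace Summit.NavierStokesRegularity.NavierStokesRegularity.Theorems

namespace DSSOneShift

open Set Metric

variable {ι : Type*} [Fintype ι] [DecidableEq ι] {κ : Type*} [Fintype κ]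

/-! ### The lifted state space `ι ⊕ Unit` -/

/-- The lifted state `(x, 1)`. [folklore] -/
def lift (x : ι → ℝ) : ι ⊕ Unit → ℝ := Sum.elim x fun _ => 1

omit [Fintype ι] [DecidableEq ι] in
/-- Components of the lift. [folklore] -/
@[simp] theorem lift_inl (x : ι → ℝ) (c : ι) : lift x (Sum.inl c) = x c := rfl

omit [Fintype ι] [DecidableEq ι] in
/-- The homogenising coordinate of the lift is `1`. [folklore] -/
@[simp] theorem lift_inr (x : ι → ℝ) (u : Unit) : lift x (Sum.inr u) = 1 := rfl

/-- The linear part of the lift: `z ↦ (z, 0)`. [folklore] -/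
def liftCLM : (ι → ℝ) →L[ℝ] (ι ⊕ Unit → ℝ) :=
  ContinuousLinearMap.pi fun c => Sum.elim (fun i => ContinuousLinearMap.proj i) (fun _ => 0) c

/-- The projection back to `ι`. [folklore] -/
def projCLM : (ι ⊕ Unit → ℝ) →L[ℝ] (ι → ℝ) :=
  ContinuousLinearMap.pi fun i => ContinuousLinearMap.proj (Sum.inl i)

omit [Fintype ι] [DecidableEq ι] in
/-- `liftCLM z = (z, 0)`. [folklore] -/
theorem liftCLM_apply (z : ι → ℝ) : liftCLM z = Sum.elim z (fun _ => (0 : ℝ)) := by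
  ext c; rcases c with c | u <;> simp [liftCLM]

omit [Fintype ι] [DecidableEq ι] in
/-- `projCLM x̂ = x̂ ∘ inl`. [folklore] -/
@[simp] theorem projCLM_apply (y : ι ⊕ Unit → ℝ) (i : ι) : projCLM y i = y (Sum.inl i) := by
  simp [projCLM]

omit [Fintype ι] [DecidableEq ι] in
/-- The lift is affine with linear part `liftCLM`. [folklore] -/
theorem lift_eq (x z : ι → ℝ) : lift (x + z) = lift x + liftCLM z := by
  ext c; rcases c with c | u <;> simp [lift, liftCLM_apply]

omit [DecidableEq ι] in
/-- The lift has derivative `liftCLM` everywhere. [folklore] -/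
theorem hasFDerivAt_lift (x : ι → ℝ) : HasFDerivAt (lift : (ι → ℝ) → ι ⊕ Unit → ℝ) liftCLM x := by
  have h : (lift : (ι → ℝ) → ι ⊕ Unit → ℝ) = fun z => liftCLM z + lift 0 := by
    funext z
    have := lift_eq (0 : ι → ℝ) z
    rw [zero_add] at this
    rw [this, add_comm]
  rw [h]
  exact liftCLM.hasFDerivAt.add_const _

/-! ### Factors and terms as (bi)linear maps of the lifted state -/

namespace Factor

/-- A factor as a linear functional of the lifted state: a coordinate, or `e · x̂_⋆`. [folklore] -/
def lin : Factor ι → ((ι ⊕ Unit → ℝ) →ₗ[ℝ] ℝ)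
  | coord c => LinearMap.proj (Sum.inl c)
  | ext e => e • LinearMap.proj (Sum.inr ())

omit [Fintype ι] [DecidableEq ι] in
/-- On the lift the linear functional is the factor's value. [folklore] -/
@[simp] theorem lin_lift (φ : Factor ι) (x : ι → ℝ) : φ.lin (lift x) = φ.val x := by
  cases φ with
  | coord c => simp [lin, val]
  | ext e => simp [lin, val]

end Factor

/-- Component `i` of the bilinear form: `Σ_k [out_k = i] coef_k · (fa_k · u) (fb_k · v)`. [folklore] -/
def termBilinComp (T : κ → BTerm ι) (i : ι) : (ι ⊕ Unit → ℝ) →ₗ[ℝ] (ι ⊕ Unit → ℝ) →ₗ[ℝ] ℝ :=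
  ∑ k, (T k).coefAt i • ((LinearMap.mul ℝ ℝ).compl₁₂ (T k).fa.lin (T k).fb.lin)

omit [Fintype ι] [DecidableEq ι] in
/-- Unfolding `termBilinComp`. [folklore] -/
theorem termBilinComp_apply [DecidableEq ι] (T : κ → BTerm ι) (i : ι) (u v : ι ⊕ Unit → ℝ) :
    termBilinComp T i u v = ∑ k, (T k).coefAt i * ((T k).fa.lin u * (T k).fb.lin v) := by
  simp [termBilinComp, LinearMap.sum_apply, LinearMap.smul_apply]

/-- **The homogenised bilinear field** `Q` on `ι ⊕ Unit` (zero in the homogenising component). [folklore; cite: cell vocabulary, harvest/h2-tao-ladder rung1/KERNEL-CHEAP-REPLAY-SPEC.md §7 (R2)] -/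
def termBilin (T : κ → BTerm ι) : (ι ⊕ Unit → ℝ) →ₗ[ℝ] (ι ⊕ Unit → ℝ) →ₗ[ℝ] (ι ⊕ Unit → ℝ) :=
  LinearMap.mk₂ ℝ (fun u v => Sum.elim (fun i => termBilinComp T i u v) (fun _ => 0))
    (fun u u' v => by ext c; rcases c with i | _ <;> simp)
    (fun r u v => by ext c; rcases c with i | _ <;> simp)
    (fun u v v' => by ext c; rcases c with i | _ <;> simp)
    (fun r u v => by ext c; rcases c with i | _ <;> simp)

omit [Fintype ι] in
/-- **On the lift, `Q(x̂, x̂)` is the term-list field** (state components). [folklore] -/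
theorem termBilin_lift_inl (T : κ → BTerm ι) (x : ι → ℝ) (i : ι) :
    termBilin T (lift x) (lift x) (Sum.inl i) = termField T x i := by
  simp only [termBilin, LinearMap.mk₂_apply, Sum.elim_inl, termBilinComp_apply, Factor.lin_lift, termField]
  exact Finset.sum_congr rfl fun k _ => by ring

omit [Fintype ι] [DecidableEq ι] in
/-- On the lift, the homogenising component of `Q(x̂, x̂)` vanishes. [folklore] -/
theorem termBilin_inr [DecidableEq ι] (T : κ → BTerm ι) (u v : ι ⊕ Unit → ℝ) (w : Unit) :
    termBilin T u v (Sum.inr w) = 0 := by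
  simp [termBilin, LinearMap.mk₂_apply]

/-! ### Lifting solutions, descending derivatives -/

omit [Fintype ι] in
/-- **Solutions lift.** If `y' = termField T y` within `s` at `t`, then `lift ∘ y` solves `x̂' = Q(x̂, x̂)` there.
[folklore] -/
theorem hasDerivWithinAt_lift (T : κ → BTerm ι) {y : ℝ → ι → ℝ} {s : Set ℝ} {t : ℝ}
    (hy : HasDerivWithinAt y (termField T (y t)) s t) :
    HasDerivWithinAt (fun t => lift (y t)) (termBilin T (lift (y t)) (lift (y t))) s t := by
  refine hasDerivWithinAt_pi.2 fun c => ?_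
  rcases c with i | u
  · simp only [lift_inl, termBilin_lift_inl]
    exact (hasDerivWithinAt_pi.1 hy) i
  · simp only [lift_inr, termBilin_inr]
    exact hasDerivWithinAt_const _ _ _

omit [DecidableEq ι] in
/-- **Derivatives descend to the slice.** If the lifted time-`t` map `Ψ` has derivative `L̂` within `lift '' S` at
`lift x`, then `x ↦ proj (Ψ (lift x))` has derivative `projCLM ∘ L̂ ∘ liftCLM` within `S` at `x`. [folklore] -/
theorem hasFDerivWithinAt_of_lift {S : Set (ι → ℝ)} {x : ι → ℝ} {Ψ : (ι ⊕ Unit → ℝ) → (ι ⊕ Unit → ℝ)}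
    {L : (ι ⊕ Unit → ℝ) →L[ℝ] (ι ⊕ Unit → ℝ)} (hΨ : HasFDerivWithinAt Ψ L (lift '' S) (lift x)) :
    HasFDerivWithinAt (fun z => projCLM (Ψ (lift z))) (projCLM.comp (L.comp liftCLM)) S x := by
  have h1 : HasFDerivWithinAt (fun z => Ψ (lift z)) (L.comp liftCLM) S x :=
    hΨ.comp x (hasFDerivAt_lift x).hasFDerivWithinAt (fun z hz => mem_image_of_mem _ hz)
  exact projCLM.hasFDerivAt.comp_hasFDerivWithinAt x h1

omit [Fintype ι] [DecidableEq ι] in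
/-- The entries of the descended derivative: `(projCLM ∘ L̂ ∘ liftCLM)(e_j)_i = L̂ (e_{inl j}) (inl i)`. [folklore] -/
theorem proj_comp_lift_single [DecidableEq ι] (L : (ι ⊕ Unit → ℝ) →L[ℝ] (ι ⊕ Unit → ℝ)) (i j : ι) :
    (projCLM.comp (L.comp liftCLM)) (Pi.single j 1) i = L (Pi.single (Sum.inl j) 1) (Sum.inl i) := by
  have h : liftCLM (Pi.single j (1 : ℝ) : ι → ℝ) = Pi.single (Sum.inl j) 1 := by
    ext c; rcases c with c | u <;> simp [liftCLM_apply, Pi.single_apply]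
  simp only [ContinuousLinearMap.comp_apply, projCLM_apply, h]

end DSSOneShift

end Summit.NavierStokesRegularity.NavierStokesRegularity.Theorems
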